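import Literature.AlgebraicGeometry.Resolution.PowersOfLinearForms
import Literature.AlgebraicGeometry.Resolution.DiffStableSubalgebra
import HarnessLib

/-!
# Graded, differentially stable subalgebras, II: the converse, and the structure theorem as a characterisation

Topic: `Literature/AlgebraicGeometry/Resolution`. `DiffStableSubalgebra.lean` proves that over a
perfect field `K` of exponential characteristic `p` every graded subalgebra `U ⊆ K[x]` stable under
all Hasse–Schmidt derivations `D^{(β)}` is `K[ℓ_1^{p^{e_1}}, …, ℓ_r^{p^{e_r}}]` for independent linear
forms `ℓ_j`. This file supplies the (easy) converse and packages both as an `iff`: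

* `IsGradedSubalgebra.adjoin` — a subalgebra generated by homogeneous elements is graded;
* `IsDiffStable.adjoin` — `R[S]` is stable under all `D^{(β)}` as soon as every `D^{(β)} s`, `s ∈ S`,
  lies in `R[S]` (higher Leibniz rule `hasseDeriv_mul`);
* `hasseDeriv_X_pow_of_ne`, `exists_hasseDeriv_X_pow_expChar_pow_eq_C`,
  `exists_hasseDeriv_linearForm_pow_eq_C` — in exponential characteristic `p`, every Hasse–Schmidt
  derivative of POSITIVE order of `x_i^{p^e}`, hence of `ℓ^{p^e}` for a linear form `ℓ`, is a
  CONSTANT (`(p^e choose k) = 0` in `K` for `0 < k < p^e`);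
* **`isDiffStable_adjoin_linearForm_pow`**, `isGradedSubalgebra_adjoin_linearForm_pow` (and the
  `_of_mem_span` forms): `K[ℓ_1^{p^{e_1}}, …, ℓ_r^{p^{e_r}}]` IS graded and stable under all
  Hasse–Schmidt derivations — for ANY field `K` of exponential characteristic `p` and any linear
  forms (no independence, no perfectness needed in this direction);
* **`isGradedSubalgebra_and_isDiffStable_iff`** — over a perfect field: `U` is graded and
  Hasse–Schmidt stable iff `U = K[ℓ_1^{p^{e_1}}, …, ℓ_r^{p^{e_r}}]` with `K`-linearly independent
  linear forms and sorted exponents (Hironaka 1970; Giraud 1975, §1.6 (3); Kawanoue 2007, 3.1.2.1).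

Used by `DiffStableCounterexamples.lean` (the hypotheses "all orders" and "perfect" are sharp) and
by the referee cell `pub-hironaka` (STEPS.md §A⁗: the edge algebras `G(ξ)` of Hironaka's 2017
manuscript, p.19 (8), p.21 (25)).

## References

* H. Hironaka, *Additive groups associated with points of a projective space*, Ann. of Math. 92
  (1970) 327–334. [Hironaka1970AdditiveGroups]
* J. Giraud, *Contact maximal en caractéristique positive*, Ann. Sci. ÉNS (4) 8 (1975) 201–234,
  §1.6. [Giraud1975]
* H. Kawanoue, *Toward resolution of singularities over a field of positive characteristic. I*,
  Publ. RIMS 43 (2007), Lemma 3.1.2.1. [Kawanoue2007]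
-/

open MvPolynomial

namespace Literature.AlgebraicGeometry.Resolution

/-! ## Generated subalgebras: gradedness and Hasse–Schmidt stability from the generators -/

section Adjoin

variable {σ : Type*} {R : Type*} [CommRing R]

/-- **A subalgebra generated by homogeneous elements is graded.** [folklore] -/
theorem IsGradedSubalgebra.adjoin {S : Set (MvPolynomial σ R)}
    (hS : ∀ s ∈ S, ∃ n, s.IsHomogeneous n) : IsGradedSubalgebra (Algebra.adjoin R S) := by
  intro f hf
  induction hf using Algebra.adjoin_induction with
  | mem x hx =>
    intro d
    obtain ⟨n, hn⟩ := hS x hx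
    rw [homogeneousComponent_of_mem hn]
    split_ifs
    · exact Algebra.subset_adjoin hx
    · exact zero_mem _
  | algebraMap r =>
    intro d
    have hr : (algebraMap R (MvPolynomial σ R) r).IsHomogeneous 0 := by
      rw [MvPolynomial.algebraMap_eq]
      exact isHomogeneous_C σ r
    rw [homogeneousComponent_of_mem hr]
    split_ifs
    · exact Subalgebra.algebraMap_mem _ r
    · exact zero_mem _
  | add x y _ _ ihx ihy =>
    intro d
    rw [map_add]
    exact add_mem (ihx d) (ihy d)
  | mul x y _ _ ihx ihy =>
    intro d
    rw [← sum_homogeneousComponent x, ← sum_homogeneousComponent y, Finset.sum_mul_sum]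
    simp only [map_sum]
    refine sum_mem fun i _ => sum_mem fun j _ => ?_
    rw [homogeneousComponent_of_mem
      ((homogeneousComponent_isHomogeneous i x).mul (homogeneousComponent_isHomogeneous j y))]
    split_ifs
    · exact mul_mem (ihx i) (ihy j)
    · exact zero_mem _

variable [DecidableEq σ]

/-- **`R[S]` is stable under all Hasse–Schmidt derivations as soon as the derivatives of the
generators stay in `R[S]`** (higher Leibniz rule). [folklore] -/
theorem IsDiffStable.adjoin {S : Set (MvPolynomial σ R)}
    (hS : ∀ s ∈ S, ∀ β : σ →₀ ℕ, hasseDeriv R β s ∈ Algebra.adjoin R S) :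
    IsDiffStable (Algebra.adjoin R S) := by
  intro f hf
  induction hf using Algebra.adjoin_induction with
  | mem x hx => exact hS x hx
  | algebraMap r =>
    intro β
    rw [MvPolynomial.algebraMap_eq, hasseDeriv_C]
    split_ifs
    · exact Subalgebra.algebraMap_mem (Algebra.adjoin R S) r
    · exact zero_mem _
  | add x y _ _ ihx ihy =>
    intro β
    rw [map_add]
    exact add_mem (ihx β) (ihy β)
  | mul x y _ _ ihx ihy =>
    intro β
    rw [hasseDeriv_mul]
    exact sum_mem fun c _ => mul_mem (ihx _) (ihy _)

omit [DecidableEq σ] in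
/-- `x_i^n` involves only the variable `x_i`. [folklore] -/
theorem X_pow_mem_supported_singleton (i : σ) (n : ℕ) :
    (X i ^ n : MvPolynomial σ R) ∈ supported R ({i} : Set σ) := by
  refine pow_mem ?_ n
  rw [supported_eq_adjoin_X]
  exact Algebra.subset_adjoin ⟨i, Set.mem_singleton i, rfl⟩

/-- `D^{(β)}(x_i^n) = 0` unless `β` is a multiple of `e_i`. [folklore] -/
theorem hasseDeriv_X_pow_of_ne (i : σ) (n : ℕ) {β : σ →₀ ℕ}
    (hβ : β ≠ Finsupp.single i (β i)) : hasseDeriv R β (X i ^ n : MvPolynomial σ R) = 0 := by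
  -- some other variable occurs in `β`
  have : ∃ j, j ≠ i ∧ β j ≠ 0 := by
    by_contra h
    apply hβ
    ext j
    by_cases hji : j = i
    · subst hji; rw [Finsupp.single_eq_same]
    · rw [Finsupp.single_apply, if_neg (fun h' => hji h'.symm)]
      by_contra hne
      exact h ⟨j, hji, hne⟩
  obtain ⟨j, hji, hj⟩ := this
  exact hasseDeriv_eq_zero_of_mem_supported R (X_pow_mem_supported_singleton i n)
    (by simpa using hji) hj

end Adjoin

/-! ## Powers `ℓ^{p^e}` of linear forms: all higher derivatives of positive order are constants -/

section LinearFormPow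

variable {σ : Type*} [Fintype σ] [DecidableEq σ] {K : Type*} [Field K]

/-- In exponential characteristic `p`, `(p^e choose k) = 0` in `K` for `0 < k < p^e`. [folklore] -/
theorem cast_choose_expChar_pow_eq_zero (p : ℕ) [ExpChar K p] (e : ℕ) {k : ℕ} (hk : k ≠ 0)
    (hlt : k < p ^ e) : ((p ^ e).choose k : K) = 0 := by
  cases ‹ExpChar K p› with
  | zero => simp at hlt; omega
  | prime hp =>
    rw [CharP.cast_eq_zero_iff K p]
    exact hp.dvd_choose_pow hk hlt.ne

omit [Fintype σ] in
/-- **Every Hasse–Schmidt derivative of positive order of `x_i^{p^e}` is a constant** (`1` for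
`β = p^e e_i`, else `0`), `p` the exponential characteristic. [folklore] -/
theorem exists_hasseDeriv_X_pow_expChar_pow_eq_C (p : ℕ) [ExpChar K p] (i : σ) (e : ℕ)
    {β : σ →₀ ℕ} (hβ : β ≠ 0) :
    ∃ c : K, hasseDeriv K β (X i ^ p ^ e : MvPolynomial σ K) = C c := by
  by_cases h : β = Finsupp.single i (β i)
  · have hk : β i ≠ 0 := by
      intro hk; apply hβ; rw [h, hk, Finsupp.single_zero]
    rw [h, hasseDeriv_X_pow]
    rcases Nat.lt_or_ge (p ^ e) (β i) with hlt | hge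
    · exact ⟨0, by rw [Nat.choose_eq_zero_of_lt hlt, Nat.cast_zero, zero_mul, C_0]⟩
    · rcases hge.eq_or_lt with heq | hlt
      · exact ⟨1, by rw [← heq, Nat.choose_self, Nat.sub_self, pow_zero, mul_one, Nat.cast_one, C_1]⟩
      · refine ⟨0, ?_⟩
        rw [← map_natCast (C : K →+* MvPolynomial σ K), cast_choose_expChar_pow_eq_zero p e hk hlt,
          C_0, zero_mul]
  · exact ⟨0, by rw [hasseDeriv_X_pow_of_ne i _ h, C_0]⟩

omit [DecidableEq σ] in
/-- In exponential characteristic `p`: `ℓ^{p^e} = Σ_i v_i^{p^e} x_i^{p^e}`. [folklore] -/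
theorem linearForm_pow_expChar_pow (p : ℕ) [ExpChar K p] (v : σ → K) (e : ℕ) :
    linearForm K v ^ p ^ e = ∑ i, C (v i ^ p ^ e) * X i ^ p ^ e := by
  rw [linearForm, sum_pow_char_pow]
  simp only [mul_pow, map_pow]

/-- **Every Hasse–Schmidt derivative of positive order of `ℓ^{p^e}`, `ℓ` a linear form, is a
constant.** [folklore] -/
theorem exists_hasseDeriv_linearForm_pow_eq_C (p : ℕ) [ExpChar K p] (v : σ → K) (e : ℕ)
    {β : σ →₀ ℕ} (hβ : β ≠ 0) :
    ∃ c : K, hasseDeriv K β (linearForm K v ^ p ^ e) = C c := by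
  choose c hc using fun i => exists_hasseDeriv_X_pow_expChar_pow_eq_C (K := K) p i e hβ
  refine ⟨∑ i, v i ^ p ^ e * c i, ?_⟩
  rw [linearForm_pow_expChar_pow, map_sum, map_sum]
  refine Finset.sum_congr rfl fun i _ => ?_
  rw [C_mul', map_smul, hc i, ← C_mul', ← C_mul]

/-- **`K[ℓ_1^{p^{e_1}}, …, ℓ_r^{p^{e_r}}]` is stable under all Hasse–Schmidt derivations**, for any
family of linear forms over any field of exponential characteristic `p`. [folklore] -/
theorem isDiffStable_adjoin_linearForm_pow (p : ℕ) [ExpChar K p] {ι : Type*} (v : ι → σ → K)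
    (e : ι → ℕ) :
    IsDiffStable (Algebra.adjoin K (Set.range fun j => linearForm K (v j) ^ p ^ e j)) := by
  refine IsDiffStable.adjoin fun s hs β => ?_
  obtain ⟨j, rfl⟩ := hs
  show hasseDeriv K β (linearForm K (v j) ^ p ^ e j) ∈ _
  by_cases hβ : β = 0
  · subst hβ
    rw [hasseDeriv_zero, LinearMap.id_apply]
    exact Algebra.subset_adjoin ⟨j, rfl⟩
  · obtain ⟨c, hc⟩ := exists_hasseDeriv_linearForm_pow_eq_C p (v j) (e j) hβ
    rw [hc, ← MvPolynomial.algebraMap_eq]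
    exact Subalgebra.algebraMap_mem _ c

omit [DecidableEq σ] in
/-- `K[ℓ_1^{q_1}, …, ℓ_r^{q_r}]` is a graded subalgebra, for any linear forms and exponents.
[folklore] -/
theorem isGradedSubalgebra_adjoin_linearForm_pow {ι : Type*} (v : ι → σ → K) (q : ι → ℕ) :
    IsGradedSubalgebra (Algebra.adjoin K (Set.range fun j => linearForm K (v j) ^ q j)) := by
  refine IsGradedSubalgebra.adjoin ?_
  rintro _ ⟨j, rfl⟩
  exact ⟨q j, by simpa using (isHomogeneous_linearForm (v j)).pow (q j)⟩

/-- `K[ℓ_1^{p^{e_1}}, …, ℓ_r^{p^{e_r}}]` is Hasse–Schmidt stable — forms given as elements of the span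
of the variables. [folklore] -/
theorem isDiffStable_adjoin_pow_of_mem_span (p : ℕ) [ExpChar K p] {ι : Type*}
    (ℓ : ι → MvPolynomial σ K)
    (hℓ : ∀ j, ℓ j ∈ Submodule.span K (Set.range (X : σ → MvPolynomial σ K))) (e : ι → ℕ) :
    IsDiffStable (Algebra.adjoin K (Set.range fun j => ℓ j ^ p ^ e j)) := by
  choose v hv using fun j => exists_linearForm_eq_of_mem_span (hℓ j)
  have : (fun j => ℓ j ^ p ^ e j) = fun j => linearForm K (v j) ^ p ^ e j :=
    funext fun j => by rw [hv]
  rw [this]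
  exact isDiffStable_adjoin_linearForm_pow p v e

omit [DecidableEq σ] in
/-- `K[ℓ_1^{q_1}, …, ℓ_r^{q_r}]` is graded — forms given as elements of the span of the variables.
[folklore] -/
theorem isGradedSubalgebra_adjoin_pow_of_mem_span {ι : Type*} (ℓ : ι → MvPolynomial σ K)
    (hℓ : ∀ j, ℓ j ∈ Submodule.span K (Set.range (X : σ → MvPolynomial σ K))) (q : ι → ℕ) :
    IsGradedSubalgebra (Algebra.adjoin K (Set.range fun j => ℓ j ^ q j)) := by
  choose v hv using fun j => exists_linearForm_eq_of_mem_span (hℓ j)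
  have : (fun j => ℓ j ^ q j) = fun j => linearForm K (v j) ^ q j := funext fun j => by rw [hv]
  rw [this]
  exact isGradedSubalgebra_adjoin_linearForm_pow v q

/-- **The structure theorem as a characterisation** (Hironaka 1970; Giraud 1975; Kawanoue 2007):
over a perfect field `K` of exponential characteristic `p`, a subalgebra `U ⊆ K[x_1, …, x_n]` is
graded and stable under all Hasse–Schmidt derivations if and only if
`U = K[ℓ_1^{p^{e_1}}, …, ℓ_r^{p^{e_r}}]` for `K`-linearly independent linear forms `ℓ_j` and
exponents `e_1 ≤ … ≤ e_r`. [cite: Kawanoue2007, Lemma 3.1.2.1] [cite: Hironaka1970AdditiveGroups]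
[cite: Giraud1975, §1.6 (3)] -/
theorem isGradedSubalgebra_and_isDiffStable_iff (p : ℕ) [ExpChar K p] [PerfectRing K p]
    (U : Subalgebra K (MvPolynomial σ K)) :
    (IsGradedSubalgebra U ∧ IsDiffStable U) ↔
      ∃ (r : ℕ) (ℓ : Fin r → MvPolynomial σ K) (e : Fin r → ℕ),
        (∀ j, ℓ j ∈ Submodule.span K (Set.range (X : σ → MvPolynomial σ K))) ∧
        LinearIndependent K ℓ ∧ Monotone e ∧
        U = Algebra.adjoin K (Set.range fun j => ℓ j ^ p ^ e j) := by
  constructor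
  · rintro ⟨hUg, hUd⟩
    exact exists_eq_adjoin_pow_linearForms_of_isDiffStable p U hUg hUd
  · rintro ⟨r, ℓ, e, hℓ, -, -, rfl⟩
    exact ⟨isGradedSubalgebra_adjoin_pow_of_mem_span ℓ hℓ _,
      isDiffStable_adjoin_pow_of_mem_span p ℓ hℓ e⟩

end LinearFormPow

end Literature.AlgebraicGeometry.Resolution
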